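import Summits.Ventures.CertifiedManyBodySolver.Transport.LTIPrimalHubbardChainTLM
import HarnessLib

/-!
# Ventures/CertifiedManyBodySolver — Transport/LTIPrimalHubbardChainEntTLM.lean

Speedrun cell sr-mbsolver — LIT team (lit-1 gen-6), D-19 r115 (3): the ENT node (`Transport/LTIPrimalHubbardChainEnt.lean`) in the
LITERAL SHAPE of op-08's formulation-B problem files (`code/oplayer/tl_marginal.py`, kind `tl_marginal`, `G`-free issue r115):
objective `toSpin (tlmObjective t U n)` (`h_avg`) and the site-averaged total-density row `Re tr(toSpin (tlmDensity n) ρ) = filling`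
(`Transport/LTIPrimalHubbardChainTLM.lean`); all other rows (PSD, trace, LTI, `(N↑,N↓)` sector zeros, real entries bounded by one,
entropy row `0 ≤ S(ρ) − S(tr_{n+1} ρ)`) verbatim. `ent_tlm_chainWindow_energyPerSite_ge` (every ring), `ent_tlm_chainWindow_energyDensity_ge`
(filling `1` ⇒ `E ≤ hubbardChainEnergyDensity t U`), `ent_tlm_chainWindow_energyDensityAt_ge` (filling `p/q`).
HONEST FRAMING: first certified bounds; not a superconductivity verdict; every number certified or labelled float.
[cite: KullEtAl2024, §II.B, §VI.B] [cite: FawziFawziScalet2024Entropy, Theorem 4.1] [cite: Han2020Bootstrap, §2]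
-/

noncomputable section

open Matrix Complex Filter Topology
open scoped ComplexOrder
open Literature.Probability.LatticeModels
open Literature.MathematicalPhysics.QuantumLattice
open Literature.MathematicalPhysics.QuantumLattice.HubbardWave0
open Literature.MathematicalPhysics.QuantumLattice.ThermodynamicLimit
open Literature.MathematicalPhysics.QuantumLattice.JordanWigner
open Literature.MathematicalPhysics.QuantumManyBody.StateRelaxation
open Literature.InformationTheory.Entropy (vonNeumannEntropy)

namespace Summit.Ventures.CertifiedManyBodySolver.Transport

/-! ### The ENT node in `tl_marginal` shape: transport to every ring and to the thermodynamic limit -/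

section Node

variable {L : ℕ} [NeZero L]

/-- **THEOREM ENT-B0 in `tl_marginal` shape (ring form).** Window `W' = {-1, …, n+1}` (`k = n + 3` sites). If `E ≤ Re tr(toSpin(h_avg) ρ)`
for every window variable `ρ : Op (PolySite W') 4` with `ρ ⪰ 0`, `tr ρ = 1`, the local-translation-invariance row, `(N↑,N↓)` sector
zeros, the site-averaged TOTAL density row `Re tr(toSpin(n_avg) ρ) = ν` (`ν = 2·nh/L`), real entries bounded by one, and the entropy row
`0 ≤ S(ρ) − S(tr_{n+1} ρ)`, then `E ≤ E₀(ring L, N = 2nh)/L` for every `L ≥ 3`, `nh ≤ L`, with `x ↦ x mod L` injective on `{-1, …, 2n+3}`.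
[cite: KullEtAl2024, §II.B, §VI.B] [cite: FawziFawziScalet2024Entropy, Theorem 4.1] -/
theorem ent_tlm_chainWindow_energyPerSite_ge (t U : ℝ) (n : ℕ) (hL : 3 ≤ L) {nh : ℕ} (hn : nh ≤ L)
    (hInj : Set.InjOn (Torus.proj (d := 1) L) ↑(chainWindow (-1) (2 * (n : ℤ) + 3)))
    {ν E : ℝ} (hν : ν = 2 * (nh : ℝ) / (L : ℝ))
    (hclaim : ∀ ρ : Op (PolySite (chainWindow (-1) ((n : ℤ) + 1))) 4, ρ.PosSemidef → ρ.trace = 1 →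
      spinPartialTrace ((PolySite.affEmb 1 (unitVec 0) (chainWindow (-1) (n : ℤ))).trans
          (PolySite.incl (affShiftSet_chainWindow_subset (-1) (n : ℤ)))) ρ =
        spinPartialTrace (PolySite.incl (chainWindow_mono_right (-1) (by omega : (n : ℤ) ≤ n + 1))) ρ →
      (∀ σ : Fin 2, ∀ k k' : TensorIndex (PolySite (chainWindow (-1) ((n : ℤ) + 1))) 4,
        (∑ x, if σ ∈ siteOcc (k x) then 1 else 0 : ℕ) ≠ (∑ x, if σ ∈ siteOcc (k' x) then 1 else 0 : ℕ) → ρ k k' = 0) →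
      ((toSpin (tlmDensity n) * ρ).trace).re = ν →
      (∀ k k' : TensorIndex (PolySite (chainWindow (-1) ((n : ℤ) + 1))) 4, starRingEnd ℂ (ρ k k') = ρ k k') →
      (∀ k k' : TensorIndex (PolySite (chainWindow (-1) ((n : ℤ) + 1))) 4, ‖ρ k k'‖ ≤ 1) →
      0 ≤ vonNeumannEntropy ρ -
        vonNeumannEntropy (spinPartialTrace (PolySite.incl (chainWindow_mono_right (-1) (by omega : (n : ℤ) ≤ n + 1))) ρ) →
      E ≤ ((toSpin (tlmObjective t U n) * ρ).trace).re) :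
    E ≤ energyPerSite (hubbardChain L) t U (2 * nh) := by
  obtain ⟨ρ, hρpsd, hρtr, hρLTI, hρsec, hρdens, hρreal, hρbd, hρent, hobj⟩ :=
    exists_lti_ent_feasible_chainWindow t U n hL hn hInj
  have hd : ((toSpin (tlmDensity n) * ρ).trace).re = ν := by
    rw [trace_tlmDensity_eq_of_lti n hρLTI, Complex.re_sum, Fin.sum_univ_two, hρdens, hρdens, hν]
    ring
  have ho : ((toSpin (tlmObjective t U n) * ρ).trace).re = energyPerSite (hubbardChain L) t U (2 * nh) := by
    rw [trace_tlmObjective_eq_of_lti n t U hρLTI, hobj]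
  exact ho ▸ hclaim ρ hρpsd hρtr hρLTI hρsec hd hρreal hρbd hρent

/-- **THEOREM ENT-B0 in `tl_marginal` shape (thermodynamic limit, half filling):** with the site-averaged total density row
`Re tr(toSpin(n_avg) ρ) = 1` (`filling = 1`), `E ≤ hubbardChainEnergyDensity t U` (`U ≥ 0`).
[cite: KullEtAl2024, §II.B, §VI.B] [cite: FawziFawziScalet2024Entropy, Theorem 4.1] [cite: Ruelle1969, §2.2] -/
theorem ent_tlm_chainWindow_energyDensity_ge (t : ℝ) {U : ℝ} (hU : 0 ≤ U) (n : ℕ) {E : ℝ}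
    (hclaim : ∀ ρ : Op (PolySite (chainWindow (-1) ((n : ℤ) + 1))) 4, ρ.PosSemidef → ρ.trace = 1 →
      spinPartialTrace ((PolySite.affEmb 1 (unitVec 0) (chainWindow (-1) (n : ℤ))).trans
          (PolySite.incl (affShiftSet_chainWindow_subset (-1) (n : ℤ)))) ρ =
        spinPartialTrace (PolySite.incl (chainWindow_mono_right (-1) (by omega : (n : ℤ) ≤ n + 1))) ρ →
      (∀ σ : Fin 2, ∀ k k' : TensorIndex (PolySite (chainWindow (-1) ((n : ℤ) + 1))) 4,
        (∑ x, if σ ∈ siteOcc (k x) then 1 else 0 : ℕ) ≠ (∑ x, if σ ∈ siteOcc (k' x) then 1 else 0 : ℕ) → ρ k k' = 0) →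
      ((toSpin (tlmDensity n) * ρ).trace).re = 1 →
      (∀ k k' : TensorIndex (PolySite (chainWindow (-1) ((n : ℤ) + 1))) 4, starRingEnd ℂ (ρ k k') = ρ k k') →
      (∀ k k' : TensorIndex (PolySite (chainWindow (-1) ((n : ℤ) + 1))) 4, ‖ρ k k'‖ ≤ 1) →
      0 ≤ vonNeumannEntropy ρ -
        vonNeumannEntropy (spinPartialTrace (PolySite.incl (chainWindow_mono_right (-1) (by omega : (n : ℤ) ≤ n + 1))) ρ) →
      E ≤ ((toSpin (tlmObjective t U n) * ρ).trace).re) :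
    E ≤ hubbardChainEnergyDensity t U := by
  obtain ⟨L₀, hL₀⟩ := exists_forall_le_injOn_proj (chainWindow (-1) (2 * (n : ℤ) + 3))
  refine hubbardChainEnergyDensity_ge_of_forall_ge t hU (max L₀ 3) fun L hL hLe => ?_
  have hL3 : 3 ≤ L := le_trans (le_max_right _ _) hL
  have hLL : L₀ ≤ L := le_trans (le_max_left _ _) hL
  haveI : NeZero L := ⟨by omega⟩
  obtain ⟨m, hm⟩ := hLe
  have hmL : m ≤ L := by omega
  have hL0 : (L : ℝ) ≠ 0 := Nat.cast_ne_zero.2 (by omega)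
  have hν : (1 : ℝ) = 2 * (m : ℝ) / (L : ℝ) := by
    rw [eq_div_iff hL0, hm]
    push_cast
    ring
  have key := ent_tlm_chainWindow_energyPerSite_ge (L := L) t U n hL3 hmL (hL₀ L hLL) hν hclaim
  rw [energyPerSite_fermionTorusGraph_one] at key
  have h2 : 2 * m = L := by omega
  rw [h2] at key
  exact key

/-- **THEOREM ENT-B0 in `tl_marginal` shape (thermodynamic limit, filling `p/q`):** with the site-averaged total density row
`Re tr(toSpin(n_avg) ρ) = p/q` particles per site (`1 ≤ q`, `p ≤ 2q`; per-spin density `p/(2q)`), `E ≤ hubbardChainEnergyDensityAt t U p q`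
(`U ≥ 0`). [cite: KullEtAl2024, §II.B, §VI.B] [cite: FawziFawziScalet2024Entropy, Theorem 4.1] [cite: Ruelle1969, §2.2] -/
theorem ent_tlm_chainWindow_energyDensityAt_ge (t : ℝ) {U : ℝ} (hU : 0 ≤ U) {p q : ℕ} (hq : 1 ≤ q) (hp : p ≤ 2 * q)
    (n : ℕ) {E : ℝ}
    (hclaim : ∀ ρ : Op (PolySite (chainWindow (-1) ((n : ℤ) + 1))) 4, ρ.PosSemidef → ρ.trace = 1 →
      spinPartialTrace ((PolySite.affEmb 1 (unitVec 0) (chainWindow (-1) (n : ℤ))).trans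
          (PolySite.incl (affShiftSet_chainWindow_subset (-1) (n : ℤ)))) ρ =
        spinPartialTrace (PolySite.incl (chainWindow_mono_right (-1) (by omega : (n : ℤ) ≤ n + 1))) ρ →
      (∀ σ : Fin 2, ∀ k k' : TensorIndex (PolySite (chainWindow (-1) ((n : ℤ) + 1))) 4,
        (∑ x, if σ ∈ siteOcc (k x) then 1 else 0 : ℕ) ≠ (∑ x, if σ ∈ siteOcc (k' x) then 1 else 0 : ℕ) → ρ k k' = 0) →
      ((toSpin (tlmDensity n) * ρ).trace).re = (p : ℝ) / (q : ℝ) →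
      (∀ k k' : TensorIndex (PolySite (chainWindow (-1) ((n : ℤ) + 1))) 4, starRingEnd ℂ (ρ k k') = ρ k k') →
      (∀ k k' : TensorIndex (PolySite (chainWindow (-1) ((n : ℤ) + 1))) 4, ‖ρ k k'‖ ≤ 1) →
      0 ≤ vonNeumannEntropy ρ -
        vonNeumannEntropy (spinPartialTrace (PolySite.incl (chainWindow_mono_right (-1) (by omega : (n : ℤ) ≤ n + 1))) ρ) →
      E ≤ ((toSpin (tlmObjective t U n) * ρ).trace).re) :
    E ≤ hubbardChainEnergyDensityAt t U p q := by
  obtain ⟨L₀, hL₀⟩ := exists_forall_le_injOn_proj (chainWindow (-1) (2 * (n : ℤ) + 3))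
  refine hubbardChainEnergyDensityAt_ge_of_frequently_ge t hU hq hp (Filter.frequently_atTop.2 fun m => ?_)
  set k : ℕ := max m (max L₀ 3) with hk
  have hkm : m ≤ k := le_max_left _ _
  have hkL : L₀ ≤ k := le_trans (le_max_left _ _) (le_max_right _ _)
  have hk3 : 3 ≤ k := le_trans (le_max_right _ _) (le_max_right _ _)
  refine ⟨2 * k, by omega, ?_⟩
  have hL3 : 3 ≤ q * (2 * k) := le_trans hk3 (by nlinarith)
  have hLL : L₀ ≤ q * (2 * k) := le_trans hkL (by nlinarith)
  haveI : NeZero (q * (2 * k)) := ⟨by omega⟩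
  have hn : p * k ≤ q * (2 * k) := by nlinarith
  have hq0 : (q : ℝ) ≠ 0 := Nat.cast_ne_zero.2 (by omega)
  have hqk : ((q * (2 * k) : ℕ) : ℝ) ≠ 0 := Nat.cast_ne_zero.2 (by omega)
  have hν : (p : ℝ) / (q : ℝ) = 2 * ((p * k : ℕ) : ℝ) / ((q * (2 * k) : ℕ) : ℝ) := by
    rw [div_eq_div_iff hq0 hqk]
    push_cast
    ring
  have key := ent_tlm_chainWindow_energyPerSite_ge (L := q * (2 * k)) t U n hL3 hn (hL₀ _ hLL) hν hclaim
  rw [energyPerSite_fermionTorusGraph_one] at key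
  have hN : 2 * (p * k) = p * (2 * k) := by ring
  rw [hN] at key
  exact key

end Node

end Summit.Ventures.CertifiedManyBodySolver.Transport
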